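import Literature.AnabelianGeometry.AbsoluteAnabelian.AutHolomorphicSpacesRCGroupLemmas
import Literature.Analysis.Complex.UnitDiscRCAutomorphisms
import Mathlib.GroupTheory.Commensurable
import Mathlib.GroupTheory.OrderOfElement
import HarnessLib

/-!
# [AbsTopIII] Prop. 2.2 (ii), first part, DISCHARGED: `Aut^{RC-hol}` of an Aut-holomorphic disc

PROOF-ONLY companion of `AutHolomorphicSpaces` (owner module, abc-iut L4-t2): kernel proof of the
named `Prop` fact `DiscRCHolAutClosedCommTerminal` — S. Mochizuki, *Topics in absolute anabelian
geometry III*, Prop. 2.2 (ii) p.52: for an Aut-holomorphic disc `X`, the RC-holomorphic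
automorphisms of `X` form a subgroup of the self-homeomorphism group of `X = ⊤` containing
`Aut^hol(X)` with index `2`, closed in the compact-open topology and commensurably terminal.

Route.  `H` := the self-homeomorphisms whose disc picture preserves `cosh` of the hyperbolic
distance; `H = Aut^{RC-hol}` by Beardon 7.4.1 (`UnitDiscIsometries`) and the type-constancy of
RC-holomorphic maps (`AutHolomorphicSpacesHolTypeProofs`); closedness because evaluation is
continuous; index two via the reflection `z ↦ z̄`; commensurable terminality WITHOUT Lie theory:
rotations and half-turns are infinitely divisible in `Aut(𝔻)` and generate it
(`UnitDiscAutGenerators`), divisible elements lie in every finite-index subgroup (normal core +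
`g ^ index ∈ N`), so an element `γ` of the commensurator conjugates `Aut^hol` into `H`, then (squares)
into `Aut^hol`, i.e. its picture normalises `Aut(𝔻)` and is therefore Möbius or anti-Möbius by the
normaliser theorem of `UnitDiscRCAutomorphisms`.

HONEST FRAMING: our kernel check of a classical statement of a refereed paper; nothing here bears
on [IUTchIII] Cor. 3.12.  Bib key `MochizukiAbsTopIII2015`; locators = kurims manuscript pages.
-/

noncomputable section

namespace Literature.AnabelianGeometry.AbsoluteAnabelian

open _root_.TopologicalSpace _root_.Topology _root_.Set _root_.Metric _root_.Function _root_.Filter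
open scoped _root_.Manifold _root_.ContDiff ComplexConjugate Pointwise
open Literature.Analysis.Complex

/-- **[AbsTopIII] Prop. 2.2 (ii), first part, holds as typed** (`DiscRCHolAutClosedCommTerminal`
DISCHARGED). [cite: MochizukiAbsTopIII2015, Proposition 2.2 (ii) p.52] -/
theorem discRCHolAutClosedCommTerminal_holds : DiscRCHolAutClosedCommTerminal := by
  intro X _ _ _ _ hX
  obtain ⟨e, he, hes⟩ := hX.exists_biholomorphic
  -- `Y := ⊤ ⊆ X` as a Riemann surface biholomorphic to the disc
  let tY : (⊤ : Opens X) ≃ₜ X :=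
    { toFun := Subtype.val
      invFun := fun x => ⟨x, trivial⟩
      left_inv := fun _ => rfl
      right_inv := fun _ => rfl
      continuous_toFun := continuous_subtype_val
      continuous_invFun := continuous_id.subtype_mk _ }
  have htY : MDifferentiable 𝓘(ℂ, ℂ) 𝓘(ℂ, ℂ) tY := fun y =>
    (mdifferentiableAt_opens_dom_iff (U := (⊤ : Opens X)) (Φ := id)
      (Ψ := fun y : (⊤ : Opens X) => (y : X)) (fun _ => rfl) y).2 mdifferentiableAt_id
  have htYs : MDifferentiable 𝓘(ℂ, ℂ) 𝓘(ℂ, ℂ) tY.symm := fun x =>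
    (mdifferentiableAt_opens_cod_iff (V := (⊤ : Opens X))
      (Ψ := fun x : X => (⟨x, trivial⟩ : (⊤ : Opens X))) x).2 mdifferentiableAt_id
  set eY : (⊤ : Opens X) ≃ₜ unitDiscOpens := tY.trans e with heYdef
  have heY : MDifferentiable 𝓘(ℂ, ℂ) 𝓘(ℂ, ℂ) eY := he.comp htY
  have heYs : MDifferentiable 𝓘(ℂ, ℂ) 𝓘(ℂ, ℂ) eY.symm := htYs.comp hes
  -- the subgroup of `discCosh`-isometric pictures
  let H : Subgroup ((⊤ : Opens X) ≃ₜ (⊤ : Opens X)) :=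
    { carrier := {ψ | ∀ z ∈ ball (0 : ℂ) 1, ∀ w ∈ ball (0 : ℂ) 1,
        discCosh (Function.extend Subtype.val (Subtype.val ∘ (eY.symm.trans (ψ.trans eY)))
            (fun _ => (0 : ℂ)) z)
          (Function.extend Subtype.val (Subtype.val ∘ (eY.symm.trans (ψ.trans eY)))
            (fun _ => (0 : ℂ)) w) = discCosh z w}
      mul_mem' := by
        intro a b ha hb z hz w hw
        simp only [mem_setOf_eq] at ha hb ⊢
        rw [pic_mul eY a b hz, pic_mul eY a b hw, ha _ (mapsTo_extend _ hz) _ (mapsTo_extend _ hw)]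
        exact hb z hz w hw
      one_mem' := by
        intro z hz w hw
        rw [pic_one eY hz, pic_one eY hw]
      inv_mem' := by
        intro a ha z hz w hw
        simp only [mem_setOf_eq] at ha
        have := ha _ (mapsTo_extend (eY.symm.trans (a⁻¹.trans eY)) hz)
          _ (mapsTo_extend (eY.symm.trans (a⁻¹.trans eY)) hw)
        rw [pic_apply_inv eY a hz, pic_apply_inv eY a hw] at this
        exact this.symm }
  have hmemH : ∀ ψ, ψ ∈ H ↔ ∀ z ∈ ball (0 : ℂ) 1, ∀ w ∈ ball (0 : ℂ) 1,
      discCosh (Function.extend Subtype.val (Subtype.val ∘ (eY.symm.trans (ψ.trans eY)))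
          (fun _ => (0 : ℂ)) z)
        (Function.extend Subtype.val (Subtype.val ∘ (eY.symm.trans (ψ.trans eY)))
          (fun _ => (0 : ℂ)) w) = discCosh z w := fun ψ => Iff.rfl
  -- `Aut^hol ≤ H`
  have hle : holAut (⊤ : Opens X) ≤ H := by
    intro ψ hψ
    rw [mem_holAut_iff] at hψ
    rw [hmemH]
    intro z hz w hw
    exact (isDiscAut_pic eY heY heYs hψ.1 hψ.2).discCosh_eq (mem_ball_zero_iff.1 hz)
      (mem_ball_zero_iff.1 hw)
  refine ⟨H, ?_, hle, ?_, isClosed_setOf_discCosh_pic eY, ?_⟩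
  · -- `H = Aut^{RC-hol}`
    ext ψ
    simp only [SetLike.mem_coe, rcHolAutSet, mem_setOf_eq]
    constructor
    · intro hψ
      refine ⟨isRCHolomorphic_of_discCosh_pic eY heY heYs ((hmemH ψ).1 hψ), ?_⟩
      exact isRCHolomorphic_of_discCosh_pic eY heY heYs ((hmemH ψ⁻¹).1 (H.inv_mem hψ))
    · rintro ⟨h1, h2⟩
      exact (hmemH ψ).2 (discCosh_pic_of_isRCHolomorphic eY heY heYs h1 h2)
  · -- index two, witnessed by the reflection
    rw [Subgroup.relIndex_eq_two_iff]
    obtain ⟨κ, hκ⟩ := exists_homeomorph_pic_conj eY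
    have hκH : κ ∈ H := by
      rw [hmemH]; intro z hz w hw; rw [hκ hz, hκ hw]; exact discCosh_conj z w
    refine ⟨κ, hκH, fun b hb => ?_⟩
    have hbκ : ∀ z ∈ ball (0 : ℂ) 1,
        Function.extend Subtype.val (Subtype.val ∘ (eY.symm.trans ((b * κ).trans eY))) (fun _ => (0 : ℂ)) z =
          Function.extend Subtype.val (Subtype.val ∘ (eY.symm.trans (b.trans eY))) (fun _ => (0 : ℂ))
            (conj z) := fun z hz => by rw [pic_mul eY b κ hz, hκ hz]
    rcases mdifferentiable_or_conj_of_discCosh_pic eY heY heYs ((hmemH b).1 hb) with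
      ⟨hd, hds⟩ | ⟨c, a, hc, ha, hba⟩
    · -- `b` biholomorphic: then `b κ` is anti-Möbius, not biholomorphic
      refine Or.inr ⟨(mem_holAut_iff _).2 ⟨hd, hds⟩, fun hk => ?_⟩
      rw [mem_holAut_iff] at hk
      obtain ⟨c, a, hc, ha, -, hbe⟩ := (isDiscAut_pic eY heY heYs hd hds).exists_eq_discRot
      refine not_isDiscAut_of_eqOn_discRot_conj hc ha (fun z hz => ?_) (isDiscAut_pic eY heY heYs hk.1 hk.2)
      rw [hbκ z hz, hbe (conj_mem_unitBall hz)]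
    · -- `b` anti-Möbius: then `b κ` is Möbius, `b` is not biholomorphic
      refine Or.inl ⟨(mem_holAut_iff _).2 (mdifferentiable_of_pic_eqOn_discRot eY heY heYs hc ha
        fun z hz => ?_), fun hk => ?_⟩
      · rw [hbκ z hz, hba (conj_mem_unitBall hz)]
        simp
      · rw [mem_holAut_iff] at hk
        exact not_isDiscAut_of_eqOn_discRot_conj hc ha hba (isDiscAut_pic eY heY heYs hk.1 hk.2)
  · -- commensurable terminality
    apply le_antisymm
    · intro γ hγ
      -- divisible biholomorphic elements lie in every conjugate `δ H δ⁻¹`, `δ` in the commensurator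
      have hkey : ∀ δ ∈ Subgroup.Commensurable.commensurator H, ∀ d : (⊤ : Opens X) ≃ₜ (⊤ : Opens X),
          (∀ n : ℕ, n ≠ 0 → ∃ r : (⊤ : Opens X) ≃ₜ (⊤ : Opens X),
            (MDifferentiable 𝓘(ℂ, ℂ) 𝓘(ℂ, ℂ) r ∧ MDifferentiable 𝓘(ℂ, ℂ) 𝓘(ℂ, ℂ) r.symm) ∧ r ^ n = d) →
          d ∈ ConjAct.toConjAct δ • H := by
        intro δ hδ d hd
        rw [Subgroup.Commensurable.commensurator_mem_iff] at hδ
        set L := ConjAct.toConjAct δ • H with hL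
        haveI hfi : (L.subgroupOf H).FiniteIndex := ⟨hδ.1⟩
        set C := (L.subgroupOf H).normalCore with hC
        haveI : C.Normal := Subgroup.normalCore_normal _
        have hN : C.index ≠ 0 := Subgroup.FiniteIndex.index_ne_zero
        obtain ⟨r, ⟨hr, hrs⟩, hrn⟩ := hd C.index hN
        have hrH : r ∈ H := hle ((mem_holAut_iff _).2 ⟨hr, hrs⟩)
        have hpow : (⟨r, hrH⟩ : H) ^ C.index ∈ C := Subgroup.pow_index_mem C ⟨r, hrH⟩
        have hK : (⟨r, hrH⟩ : H) ^ C.index ∈ L.subgroupOf H := Subgroup.normalCore_le _ hpow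
        rw [Subgroup.mem_subgroupOf, Subgroup.coe_pow] at hK
        rw [← hrn]
        exact hK
      have hconj : ∀ δ ∈ Subgroup.Commensurable.commensurator H, ∀ d : (⊤ : Opens X) ≃ₜ (⊤ : Opens X),
          (∀ n : ℕ, n ≠ 0 → ∃ r : (⊤ : Opens X) ≃ₜ (⊤ : Opens X),
            (MDifferentiable 𝓘(ℂ, ℂ) 𝓘(ℂ, ℂ) r ∧ MDifferentiable 𝓘(ℂ, ℂ) 𝓘(ℂ, ℂ) r.symm) ∧ r ^ n = d) →
          δ * d * δ⁻¹ ∈ H := by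
        intro δ hδ d hd
        have hδ' : δ⁻¹ ∈ Subgroup.Commensurable.commensurator H := Subgroup.inv_mem _ hδ
        have hmem := hkey δ⁻¹ hδ' d hd
        rw [Subgroup.mem_pointwise_smul_iff_inv_smul_mem, ← map_inv, inv_inv, ConjAct.toConjAct_smul]
          at hmem
        exact hmem
      -- Step 1/2: `γ` conjugates `Aut^hol` into `Aut^hol`
      have hstep : ∀ f ∈ holAut (⊤ : Opens X), γ * f * γ⁻¹ ∈ holAut (⊤ : Opens X) := by
        intro f hf
        rw [mem_holAut_iff] at hf
        obtain ⟨ρ₁, ρ₂, ρ₃, hfe, hdiv⟩ := exists_eq_mul_mul_divisible eY heY heYs hf.1 hf.2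
        have hsq : ∀ ρ ∈ ({ρ₁, ρ₂, ρ₃} : Set ((⊤ : Opens X) ≃ₜ (⊤ : Opens X))),
            γ * ρ * γ⁻¹ ∈ holAut (⊤ : Opens X) := by
          intro ρ hρ
          obtain ⟨r, ⟨hr, hrs⟩, hr2⟩ := hdiv ρ hρ 2 two_ne_zero
          -- `r` is itself a product of divisible elements, so `γ r γ⁻¹ ∈ H`
          obtain ⟨σ₁, σ₂, σ₃, hre, hrdiv⟩ := exists_eq_mul_mul_divisible eY heY heYs hr hrs
          have hrH : γ * r * γ⁻¹ ∈ H := by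
            have h1 := hconj γ hγ σ₁ (hrdiv σ₁ (by simp))
            have h2 := hconj γ hγ σ₂ (hrdiv σ₂ (by simp))
            have h3 := hconj γ hγ σ₃ (hrdiv σ₃ (by simp))
            have := H.mul_mem (H.mul_mem h1 h2) h3
            rw [hre]
            convert this using 1
            group
          have hsqd := mdifferentiable_mul_self_of_discCosh_pic eY heY heYs ((hmemH _).1 hrH)
          rw [← hr2]
          have heq : γ * r ^ 2 * γ⁻¹ = (γ * r * γ⁻¹) * (γ * r * γ⁻¹) := by rw [pow_two]; group
          rw [heq]
          exact (mem_holAut_iff _).2 hsqd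
        rw [hfe]
        have heq : γ * (ρ₁ * ρ₂ * ρ₃) * γ⁻¹ = (γ * ρ₁ * γ⁻¹) * (γ * ρ₂ * γ⁻¹) * (γ * ρ₃ * γ⁻¹) := by
          group
        rw [heq]
        exact Subgroup.mul_mem _ (Subgroup.mul_mem _ (hsq ρ₁ (by simp)) (hsq ρ₂ (by simp)))
          (hsq ρ₃ (by simp))
      -- Step 3: the picture of `γ` normalises `Aut(𝔻)`, hence is Möbius or anti-Möbius
      set h := Function.extend Subtype.val (Subtype.val ∘ (eY.symm.trans (γ.trans eY))) (fun _ => (0 : ℂ))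
        with hh
      set k := Function.extend Subtype.val (Subtype.val ∘ (eY.symm.trans (γ⁻¹.trans eY))) (fun _ => (0 : ℂ))
        with hk
      have hnorm : ∀ F, IsDiscAut F → IsDiscAut (h ∘ F ∘ k) := by
        intro F hF
        obtain ⟨ρ, hρ, hρs, hρe⟩ := exists_homeomorph_of_isDiscAut eY heY heYs hF
        have hm := hstep ρ ((mem_holAut_iff _).2 ⟨hρ, hρs⟩)
        rw [mem_holAut_iff] at hm
        refine (isDiscAut_pic eY heY heYs hm.1 hm.2).congr fun z hz => ?_
        simp only [comp_apply, hh, hk]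
        rw [pic_mul eY _ _ hz, pic_mul eY _ _ (mapsTo_extend _ hz), hρe (mapsTo_extend _ hz)]
      obtain ⟨c, a, hc, ha, hγe⟩ := exists_eq_discRot_or_conj_of_normalizes
        (continuousOn_extend (eY.symm.trans (γ.trans eY)).continuous) (mapsTo_extend _) (mapsTo_extend _)
        (fun z hz => pic_inv_apply eY γ hz) (fun z hz => pic_apply_inv eY γ hz) hnorm
      rw [hmemH]
      intro z hz w hw
      rcases hγe with hγe | hγe
      · rw [hγe hz, hγe hw]
        exact discCosh_discRot hc ha (mem_ball_zero_iff.1 hz) (mem_ball_zero_iff.1 hw)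
      · rw [hγe hz, hγe hw]
        exact discCosh_discRot_conj hc ha (mem_ball_zero_iff.1 hz) (mem_ball_zero_iff.1 hw)
    · intro γ hγ
      rw [Subgroup.Commensurable.commensurator_mem_iff]
      have hfix : ConjAct.toConjAct γ • H = H := by
        ext x
        rw [Subgroup.mem_pointwise_smul_iff_inv_smul_mem, ← map_inv, ConjAct.toConjAct_smul, inv_inv]
        constructor
        · intro hx
          have := H.mul_mem (H.mul_mem hγ hx) (H.inv_mem hγ)
          have heq : γ * (γ⁻¹ * x * γ) * γ⁻¹ = x := by group
          rwa [heq] at this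
        · intro hx
          exact H.mul_mem (H.mul_mem (H.inv_mem hγ) hx) hγ
      rw [hfix]

end Literature.AnabelianGeometry.AbsoluteAnabelian
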